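/-
PORT (pub-hodgecm2, COR-CM cell; slot b19 = executor of row Fg6, successor of model-2) — part 2/2 of the MINIMAL F6 CONE of the stage-1
package file `HodgeCMPerL/HodgeCM/StubTree/Qw8Monomial.lean` (md5 c9b36976df57, 894 lines): its §§6–8 (source ll. 308–571:
eigen-monomials, weight vectors along block projections, the Poincaré-dual partner `weightDual_of_facts`) VERBATIM; §§9–11 not
ported (see part 1).  Edits: imports = part 1 + `Proofs.Pohlmann.WeightLinesMonomial` (for `weightSpace_eq_monoSpan`,
`finrank_weightSpace_succ`); namespace token `HodgeCM` ↦ `Summit.HodgeConjecture.CorCM`; linter fixes.  Generator: pub-hodgecm2-p1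
portkit `build_kit.py` (via model-2's run), re-cut by hand at section boundaries.
-/
import Summits.HodgeConjecture.CorCM.StubTree.Qw8Monomial1
import Summits.HodgeConjecture.CorCM.Proofs.Pohlmann.WeightLinesMonomial
import HarnessLib

/-!
# The monomial calculus for F6, II: eigen-monomials, block pull-backs, and the Poincaré-dual partner

Port of §§6–8 of the package's `StubTree/Qw8Monomial.lean`.  §6: injective eigen-monomials `fmono x k p` of an eigenbasis are
nonzero, all weight vectors of positive degree are multiples of ONE of them (`exists_eq_smul_fmono`, N1 + `WeightLinesMonomial`),
concatenation `fmono p ∪ fmono p' = fmono (append p p')` (F5), top monomials have nonzero trace (`Fact_trTopCM`).  §7: products and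
block pull-backs of weight vectors are weight vectors (`isWeightVector_box'`, a theorem of `ModelAxioms` + N1 replacing F2).  §8:
**F6 `Fact_weightDual` in positive degree and non-full weight is a THEOREM** of `ModelAxioms`, N1 `Fact_cupExterior`, F5
`Fact_cupAssoc`, `Fact_dimProd`, `Fact_trTopCM` (`exists_partner_mono`, `weightDual_of_facts`: the partner of `c · e_S` is the
complementary monomial `e_{Sᶜ}`, `e_{Sᶜ} ∪ e_S = ± e_top`, `∫ e_top ≠ 0`).  The two edge cases (degree `0`, full weight) are
closed in `StubTree/WeightDualUnit.lean` with the unit classes `Fact_unitH0` (`Geometry/GenericFacts.lean`).  [Voisin I Thm 5.30; Lange 2023 Lemma 1.1.17]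
-/

noncomputable section

open scoped TensorProduct NumberField Classical

namespace Summit.HodgeConjecture.CorCM

open Literature.AlgebraicGeometry.Motives (CMType)
open Summit.HodgeConjecture.CorCM.Pohlmann

namespace Universe

variable {U : Universe}

/-! ## 6. Eigen-monomials: non-vanishing, lines, concatenation -/

section CM

variable {F : CMField} {n : ℕ} {Θ : Fin (n + 1) → CMType F}
  (x : (j : Fin (n + 1)) → ((F : Type) →+* ℂ) → U.CohC (U.cmAV F (Θ j)) 1)

/-- `N_{wtOf p₀} ⊆ ℂ · fmono p₀`: all injective monomials of the same weight are proportional (N1). -/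
theorem monoSpan_le_span_fmono {k : ℕ} (hE : U.CupExterior (U.cmProd F Θ) k)
    (p₀ : Fin (k + 1) → Fin (n + 1) × ((F : Type) →+* ℂ)) :
    U.monoSpan x k (wtOf k p₀) ≤ ℂ ∙ U.fmono x k p₀ := by
  refine Submodule.span_le.mpr ?_
  rintro _ ⟨p, ⟨hp, hpT⟩, rfl⟩
  obtain ⟨π, rfl⟩ := exists_perm_of_wtOf_eq hp hpT.symm
  exact fmono_comp_perm_mem_span x hE π p₀

/-- **Injective eigen-monomials of an eigenbasis are nonzero** (their weight space is a line, `WeightLines`). -/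
theorem fmono_ne_zero (M : U.ModelAxioms) (hN1 : U.Fact_cupExterior) (hx : ∀ j τ, x j τ ∈ U.eigenLine F (Θ j) τ)
    (hsp : ∀ j, Submodule.span ℂ (Set.range (x j)) = ⊤) {k : ℕ}
    {p : Fin (k + 1) → Fin (n + 1) × ((F : Type) →+* ℂ)} (hp : Function.Injective p) : U.fmono x k p ≠ 0 := by
  intro h0
  have hE := hN1 F n Θ k
  have h1 : Module.finrank ℂ (U.weightSpace F Θ (wtOf k p) (k + 1)) = 1 := by
    rw [finrank_weightSpace_succ M hN1 k, if_pos (sum_card_wtOf p hp)]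
  have hle : U.weightSpace F Θ (wtOf k p) (k + 1) ≤ ℂ ∙ U.fmono x k p := by
    rw [weightSpace_eq_monoSpan x M hx hE hsp]
    exact monoSpan_le_span_fmono x hE p
  rw [h0, Submodule.span_zero_singleton] at hle
  have h2 := Submodule.finrank_mono hle
  rw [h1, finrank_bot] at h2
  exact Nat.not_succ_le_zero 0 h2

/-- **A nonzero weight vector of positive degree is a multiple of ONE injective eigen-monomial of its weight.** -/
theorem exists_eq_smul_fmono (M : U.ModelAxioms) (hN1 : U.Fact_cupExterior)
    (hx : ∀ j τ, x j τ ∈ U.eigenLine F (Θ j) τ) (hsp : ∀ j, Submodule.span ℂ (Set.range (x j)) = ⊤) {k : ℕ}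
    {S : Fin (n + 1) → Finset ((F : Type) →+* ℂ)} {y : U.CohC (U.cmProd F Θ) (k + 1)}
    (hy : U.IsWeightVector F Θ S (k + 1) y) (hy0 : y ≠ 0) :
    ∃ p : Fin (k + 1) → Fin (n + 1) × ((F : Type) →+* ℂ), Function.Injective p ∧ wtOf k p = S ∧
      ∃ c : ℂ, y = c • U.fmono x k p := by
  classical
  have hE := hN1 F n Θ k
  have hyN : y ∈ U.monoSpan x k S := by
    rw [← weightSpace_eq_monoSpan x M hx hE hsp S]
    exact (U.mem_weightSpace_iff F Θ S _ _).2 hy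
  by_cases hne : ∃ p₀ : Fin (k + 1) → Fin (n + 1) × ((F : Type) →+* ℂ), Function.Injective p₀ ∧ wtOf k p₀ = S
  · obtain ⟨p₀, hp₀, rfl⟩ := hne
    obtain ⟨c, hc⟩ := Submodule.mem_span_singleton.mp (monoSpan_le_span_fmono x hE p₀ hyN)
    exact ⟨p₀, hp₀, rfl, c, hc.symm⟩
  · exfalso
    apply hy0
    have h0 : U.monoSpan x k S = ⊥ := by
      rw [monoSpan, Submodule.span_eq_bot]
      rintro _ ⟨p, hp, rfl⟩
      exact absurd ⟨p, hp⟩ hne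
    rw [h0] at hyN
    exact (Submodule.mem_bot ℂ).mp hyN




/-- **Concatenation of eigen-monomials**: `fmono p ∪ fmono p' = fmono (append p p')` (F5). -/
theorem cupC_fmono_fmono (h5 : U.Fact_cupAssoc) (k l : ℕ) (p : Fin (k + 1) → Fin (n + 1) × ((F : Type) →+* ℂ))
    (p' : Fin (l + 1) → Fin (n + 1) × ((F : Type) →+* ℂ)) :
    U.cupC (U.cmProd F Θ) (k + 1) (l + 1) (U.fmono x k p) (U.fmono x l p') =
      U.fmono x (k + 1 + l) (Fin.append p p' : Fin (k + 1 + (l + 1)) → _) := by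
  rw [fmono_eq, fmono_eq, fmono_eq, U.cupC_cupPowC_cupPowC h5]
  congr 1
  exact append_comp_eq (U.fvec x) p p'

/-- **Top monomials have nonzero trace**: an injective eigen-monomial of top degree `2 dim ∏_j A_{Θ_j}` has
`∫ ≠ 0` (`Fact_trTopCM`, with the degree count `Fact_dimProd` + M `Fact_cmAV`). -/
theorem trC_fmono_ne_zero (M : U.ModelAxioms) (hN1 : U.Fact_cupExterior) (ht : U.Fact_trTopCM)
    (hx : ∀ j τ, x j τ ∈ U.eigenLine F (Θ j) τ) (hsp : ∀ j, Submodule.span ℂ (Set.range (x j)) = ⊤) {K : ℕ}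
    {q : Fin (K + 1) → Fin (n + 1) × ((F : Type) →+* ℂ)} (hq : Function.Injective q)
    (h : K + 1 = 2 * U.dim (U.cmProd F Θ)) :
    U.trC (U.cmProd F Θ) (2 * U.dim (U.cmProd F Θ)) (U.castC _ h (U.fmono x K q)) ≠ 0 := by
  intro h0
  have h1 : U.castC _ h (U.fmono x K q) = 0 := by
    apply trC_top_injective ht
    rw [h0, map_zero]
  exact fmono_ne_zero x M hN1 hx hsp hq ((LinearEquiv.map_eq_zero_iff _).mp h1)

end CM

/-! ## 7. Weight vectors: products, pull-backs along block projections, dual partners -/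

/-- The zero class is a weight vector of every weight. -/
theorem isWeightVector_zero_vec (F : CMField) {n : ℕ} (Θ : Fin (n + 1) → CMType F)
    (S : Fin (n + 1) → Finset ((F : Type) →+* ℂ)) (k : ℕ) : U.IsWeightVector F Θ S k 0 :=
  fun _ _ _ _ => by rw [map_zero, smul_zero]

/-- Scalar multiples of weight vectors are weight vectors. -/
theorem isWeightVector_smul {F : CMField} {n : ℕ} {Θ : Fin (n + 1) → CMType F}
    {S : Fin (n + 1) → Finset ((F : Type) →+* ℂ)} {k : ℕ} {y : U.CohC (U.cmProd F Θ) k}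
    (hy : U.IsWeightVector F Θ S k y) (c : ℂ) : U.IsWeightVector F Θ S k (c • y) :=
  fun j a Ma hMa => by rw [map_smul, hy j a Ma hMa, smul_comm]

/-- **The cup product of weight vectors of DISJOINT weights is a weight vector of the union weight** (M3). -/
theorem isWeightVector_cupC_of_disjoint (hcup : U.Fact_pull_cup) {F : CMField} {n : ℕ}
    {Θ : Fin (n + 1) → CMType F} {S S' : Fin (n + 1) → Finset ((F : Type) →+* ℂ)}
    (hSS' : ∀ j, Disjoint (S j) (S' j)) {a b : ℕ} {y : U.CohC (U.cmProd F Θ) a} {y' : U.CohC (U.cmProd F Θ) b}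
    (hy : U.IsWeightVector F Θ S a y) (hy' : U.IsWeightVector F Θ S' b y') :
    U.IsWeightVector F Θ (fun j => S j ∪ S' j) (a + b) (U.cupC _ a b y y') := by
  intro j c Mo hMo
  rw [pullC_cupC U hcup, hy j c Mo hMo, hy' j c Mo hMo, Finset.prod_union (hSS' j)]
  simp only [map_smul, LinearMap.smul_apply, smul_smul, mul_comm]

section Block

variable {F : CMField} {n m : ℕ} (Ξ : Fin (n + 1 + (m + 1)) → CMType F)
  {pA : U.Mor (U.cmProd F Ξ) (U.cmProd F (blkA Ξ))} {pB : U.Mor (U.cmProd F Ξ) (U.cmProd F (blkB Ξ))}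

/-- `p_Y^* ∘ pr_j^* = pr_{castAdd j}^*` on `H¹ ⊗ ℂ` (the definition of a block pair, complexified). -/
theorem pullC_prC_blkA (hP : U.IsBlockPair F Ξ pA pB) (j : Fin (n + 1)) (y : U.CohC (U.cmAV F (blkA Ξ j)) 1) :
    U.pullC pA 1 (U.prC F (blkA Ξ) j y) = U.prC F Ξ (Fin.castAdd (m + 1) j) y := by
  have h := congrArg (LinearMap.baseChange ℂ) (hP.1 j 1)
  rw [LinearMap.baseChange_comp] at h
  exact LinearMap.congr_fun h y

/-- `p_{Y'}^* ∘ pr_i^* = pr_{natAdd i}^*` on `H¹ ⊗ ℂ`. -/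
theorem pullC_prC_blkB (hP : U.IsBlockPair F Ξ pA pB) (i : Fin (m + 1)) (y : U.CohC (U.cmAV F (blkB Ξ i)) 1) :
    U.pullC pB 1 (U.prC F (blkB Ξ) i y) = U.prC F Ξ (Fin.natAdd (n + 1) i) y := by
  have h := congrArg (LinearMap.baseChange ℂ) (hP.2 i 1)
  rw [LinearMap.baseChange_comp] at h
  exact LinearMap.congr_fun h y

variable (xP : (t : Fin (n + 1 + (m + 1))) → ((F : Type) →+* ℂ) → U.CohC (U.cmAV F (Ξ t)) 1)

/-- **Pull-back of an eigen-monomial of the first block = the lifted eigen-monomial of the product** (M3 + block pair). -/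
theorem pullC_fmono_blkA (hcup : U.Fact_pull_cup) (hP : U.IsBlockPair F Ξ pA pB) (k : ℕ)
    (p : Fin (k + 1) → Fin (n + 1) × ((F : Type) →+* ℂ)) :
    U.pullC pA (k + 1) (U.fmono (Θ := blkA Ξ) (fun j => xP (Fin.castAdd (m + 1) j)) k p) =
      U.fmono xP k (fun i => (Fin.castAdd (m + 1) (p i).1, (p i).2)) := by
  rw [fmono_eq, fmono_eq, pullC_cupPowC hcup]
  congr 1
  funext i
  exact U.pullC_prC_blkA Ξ hP (p i).1 (xP _ (p i).2)

/-- (Ported verbatim from the stage-1 package `HodgeCM/StubTree/Qw8Monomial.lean`; no docstring in the source.) -/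
theorem pullC_fmono_blkB (hcup : U.Fact_pull_cup) (hP : U.IsBlockPair F Ξ pA pB) (k : ℕ)
    (p : Fin (k + 1) → Fin (m + 1) × ((F : Type) →+* ℂ)) :
    U.pullC pB (k + 1) (U.fmono (Θ := blkB Ξ) (fun i => xP (Fin.natAdd (n + 1) i)) k p) =
      U.fmono xP k (fun i => (Fin.natAdd (n + 1) (p i).1, (p i).2)) := by
  rw [fmono_eq, fmono_eq, pullC_cupPowC hcup]
  congr 1
  funext i
  exact U.pullC_prC_blkB Ξ hP (p i).1 (xP _ (p i).2)

/-- **Pull-backs of weight vectors along the first block projection are weight vectors** of weight `(S, ∅)` —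
positive degree; a THEOREM of `ModelAxioms` + N1 (monomial calculus), replacing F2 `Fact_factorActDescends`. -/
theorem isWeightVector_pullC_blkA (M : U.ModelAxioms) (hN1 : U.Fact_cupExterior) (hP : U.IsBlockPair F Ξ pA pB)
    {a : ℕ} (ha : 0 < a) {S : Fin (n + 1) → Finset ((F : Type) →+* ℂ)} {y : U.CohC (U.cmProd F (blkA Ξ)) a}
    (hy : U.IsWeightVector F (blkA Ξ) S a y) :
    U.IsWeightVector F Ξ (Fin.append S (fun _ : Fin (m + 1) => (∅ : Finset ((F : Type) →+* ℂ))) :) a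
      (U.pullC pA a y) := by
  obtain ⟨k, rfl⟩ := Nat.exists_eq_add_one_of_ne_zero ha.ne'
  by_cases hy0 : y = 0
  · rw [hy0, map_zero]; exact U.isWeightVector_zero_vec F Ξ _ _
  obtain ⟨β, -, hβ⟩ := exists_integral_injective_eval F
  choose xP hxP _hx0 hsp using fun t => exists_eigenbasis M F (Ξ t) β hβ
  obtain ⟨p, hp, rfl, c, rfl⟩ := exists_eq_smul_fmono (Θ := blkA Ξ) (fun j => xP (Fin.castAdd (m + 1) j)) M hN1
    (fun j τ => hxP _ τ) (fun j => hsp _) hy hy0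
  rw [map_smul, U.pullC_fmono_blkA Ξ xP M.pull_cup hP, ← wtOf_liftA]
  refine isWeightVector_smul (isWeightVector_fmono xP M hxP k _ ?_) c
  intro i i' h
  simp only [Prod.mk.injEq, Fin.castAdd_inj] at h
  exact hp (Prod.ext h.1 h.2)

/-- The same along the second block projection: weight `(∅, S')`. -/
theorem isWeightVector_pullC_blkB (M : U.ModelAxioms) (hN1 : U.Fact_cupExterior) (hP : U.IsBlockPair F Ξ pA pB)
    {b : ℕ} (hb : 0 < b) {S' : Fin (m + 1) → Finset ((F : Type) →+* ℂ)} {y : U.CohC (U.cmProd F (blkB Ξ)) b}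
    (hy : U.IsWeightVector F (blkB Ξ) S' b y) :
    U.IsWeightVector F Ξ (Fin.append (fun _ : Fin (n + 1) => (∅ : Finset ((F : Type) →+* ℂ))) S' :) b
      (U.pullC pB b y) := by
  obtain ⟨k, rfl⟩ := Nat.exists_eq_add_one_of_ne_zero hb.ne'
  by_cases hy0 : y = 0
  · rw [hy0, map_zero]; exact U.isWeightVector_zero_vec F Ξ _ _
  obtain ⟨β, -, hβ⟩ := exists_integral_injective_eval F
  choose xP hxP _hx0 hsp using fun t => exists_eigenbasis M F (Ξ t) β hβ
  obtain ⟨p, hp, rfl, c, rfl⟩ := exists_eq_smul_fmono (Θ := blkB Ξ) (fun i => xP (Fin.natAdd (n + 1) i)) M hN1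
    (fun i τ => hxP _ τ) (fun i => hsp _) hy hy0
  rw [map_smul, U.pullC_fmono_blkB Ξ xP M.pull_cup hP, ← wtOf_liftB]
  refine isWeightVector_smul (isWeightVector_fmono xP M hxP k _ ?_) c
  intro i i' h
  simp only [Prod.mk.injEq] at h
  exact hp (Prod.ext (Fin.natAdd_inj _ |>.mp h.1) h.2)

/-- **The exterior product of weight vectors is a weight vector of the concatenated weight** — positive degrees;
a THEOREM of `ModelAxioms` + N1, replacing `isWeightVector_box` (which used F2). -/
theorem isWeightVector_box' (M : U.ModelAxioms) (hN1 : U.Fact_cupExterior) (hP : U.IsBlockPair F Ξ pA pB)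
    {a b : ℕ} (ha : 0 < a) (hb : 0 < b)
    {S : Fin (n + 1) → Finset ((F : Type) →+* ℂ)} {S' : Fin (m + 1) → Finset ((F : Type) →+* ℂ)}
    {y : U.CohC (U.cmProd F (blkA Ξ)) a} {y' : U.CohC (U.cmProd F (blkB Ξ)) b}
    (hy : U.IsWeightVector F (blkA Ξ) S a y) (hy' : U.IsWeightVector F (blkB Ξ) S' b y') :
    U.IsWeightVector F Ξ (Fin.append S S' :) (a + b)
      (U.cupC (U.cmProd F Ξ) a b (U.pullC pA a y) (U.pullC pB b y')) := by
  have h := U.isWeightVector_cupC_of_disjoint M.pull_cup (S := (Fin.append S (fun _ : Fin (m + 1) => ∅) :))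
    (S' := (Fin.append (fun _ : Fin (n + 1) => ∅) S' :)) (fun t => ?_)
    (U.isWeightVector_pullC_blkA Ξ M hN1 hP ha hy) (U.isWeightVector_pullC_blkB Ξ M hN1 hP hb hy')
  · convert h using 2 with t
    refine Fin.addCases (m := n + 1) (n := m + 1) (fun j => ?_) (fun i => ?_) t <;> simp
  · refine Fin.addCases (m := n + 1) (n := m + 1) (fun j => ?_) (fun i => ?_) t <;> simp

end Block


/-! ## 8. The Poincaré-dual partner of a weight vector: F6 `Fact_weightDual` as a THEOREM (non-full weights) -/

section Partner

variable {F : CMField} {m : ℕ} (Θ' : Fin (m + 1) → CMType F)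

/-- Core, in monomial degrees: a nonzero weight vector `y` of weight `S' ≠ (univ)_i` in degree `l + 1` is
`c · fmono p` (`c ≠ 0`); its partner is the COMPLEMENTARY eigen-monomial `fmono p'`, of weight `S'ᶜ`, and
`fmono p' ∪ y = c · fmono (append p' p)`, `y ∪ fmono p' = c · fmono (append p p')` are nonzero multiples of top
monomials, so have nonzero trace (`Fact_trTopCM`). -/
theorem exists_partner_mono (M : U.ModelAxioms) (hN1 : U.Fact_cupExterior) (h5 : U.Fact_cupAssoc)
    (hd : U.Fact_dimProd) (ht : U.Fact_trTopCM) {l : ℕ} {S' : Fin (m + 1) → Finset ((F : Type) →+* ℂ)}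
    {y : U.CohC (U.cmProd F Θ') (l + 1)} (hy : U.IsWeightVector F Θ' S' (l + 1) y) (hy0 : y ≠ 0)
    (hS' : S' ≠ fun _ => Finset.univ) :
    ∃ (l' : ℕ) (y' : U.CohC (U.cmProd F Θ') (l' + 1)), l' + 1 + (l + 1) = 2 * U.dim (U.cmProd F Θ') ∧
      U.IsWeightVector F Θ' (fun i => (S' i)ᶜ) (l' + 1) y' ∧
      U.trC _ _ (U.cupC (U.cmProd F Θ') (l' + 1) (l + 1) y' y) ≠ 0 ∧
      U.trC _ _ (U.cupC (U.cmProd F Θ') (l + 1) (l' + 1) y y') ≠ 0 := by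
  obtain ⟨β, -, hβ⟩ := exists_integral_injective_eval F
  choose xB hxB _hx0 hsp using fun i => exists_eigenbasis M F (Θ' i) β hβ
  obtain ⟨p, hp, hwt, c, rfl⟩ := U.exists_eq_smul_fmono xB M hN1 hxB hsp hy hy0
  have hc : c ≠ 0 := by rintro rfl; exact hy0 (zero_smul _ _)
  have hns : ¬Function.Surjective p := fun hs => hS' (hwt.symm.trans (wtOf_eq_univ_of_surjective hs))
  obtain ⟨l', p', hp', h1, h2, hcard⟩ := exists_compl_enum p hp hns
  have hdeg : l' + 1 + (l + 1) = 2 * U.dim (U.cmProd F Θ') := by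
    rw [hcard, card_index, two_mul_dim_cmProd_of_dimProd M hd]
  have hdeg2 : l + 1 + (l' + 1) = 2 * U.dim (U.cmProd F Θ') := by omega
  have hwt' : wtOf l' p' = fun i => (S' i)ᶜ := by rw [wtOf_eq_compl h1 h2, hwt]
  have hinj1 : Function.Injective (Fin.append p' p : Fin (l' + 1 + (l + 1)) → _) :=
    Fin.append_injective_iff.mpr ⟨hp', hp, fun i j h => h1 i ⟨j, h.symm⟩⟩
  have hinj2 : Function.Injective (Fin.append p p' : Fin (l + 1 + (l' + 1)) → _) :=
    Fin.append_injective_iff.mpr ⟨hp, hp', fun i j h => h1 j ⟨i, h⟩⟩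
  refine ⟨l', U.fmono xB l' p', hdeg, ?_, ?_, ?_⟩
  · rw [← hwt']; exact isWeightVector_fmono xB M hxB l' p' hp'
  · rw [map_smul, U.cupC_fmono_fmono xB h5, ← U.trC_castC _ hdeg, map_smul, map_smul, smul_eq_mul]
    exact mul_ne_zero hc (U.trC_fmono_ne_zero xB M hN1 ht hxB hsp hinj1 hdeg)
  · rw [map_smul, LinearMap.smul_apply, U.cupC_fmono_fmono xB h5, ← U.trC_castC _ hdeg2, map_smul, map_smul,
      smul_eq_mul]
    exact mul_ne_zero hc (U.trC_fmono_ne_zero xB M hN1 ht hxB hsp hinj2 hdeg2)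

/-- **F6 `Fact_weightDual` for weight vectors of positive degree and non-full weight is a THEOREM** of
`ModelAxioms`, N1 `Fact_cupExterior`, F5 `Fact_cupAssoc` and the two generic facts `Fact_dimProd`, `Fact_trTopCM`
(same conclusion as `Fact_weightDual`, verbatim but for the sharper `q < dim`: a non-full weight is not top). -/
theorem weightDual_of_facts (M : U.ModelAxioms) (hN1 : U.Fact_cupExterior) (h5 : U.Fact_cupAssoc)
    (hd : U.Fact_dimProd) (ht : U.Fact_trTopCM) (q : ℕ) (S' : Fin (m + 1) → Finset ((F : Type) →+* ℂ))
    (w : U.CohC (U.cmProd F Θ') (2 * q)) (hw0 : w ≠ 0) (hw : U.IsWeightVector F Θ' S' (2 * q) w) (hq : 0 < q)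
    (hS' : S' ≠ fun _ => Finset.univ) :
    q < U.dim (U.cmProd F Θ') ∧
    ∃ w' : U.CohC (U.cmProd F Θ') (2 * (U.dim (U.cmProd F Θ') - q)),
      U.IsWeightVector F Θ' (fun i => (S' i)ᶜ) (2 * (U.dim (U.cmProd F Θ') - q)) w' ∧
      U.trC (U.cmProd F Θ') _ (U.cupC (U.cmProd F Θ') _ _ w' w) ≠ 0 ∧
      U.trC (U.cmProd F Θ') _ (U.cupC (U.cmProd F Θ') _ _ w w') ≠ 0 := by
  obtain ⟨l, hl⟩ : ∃ l, 2 * q = l + 1 := ⟨2 * q - 1, by omega⟩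
  obtain ⟨l', y', hdeg, hw', htr1, htr2⟩ := U.exists_partner_mono Θ' M hN1 h5 hd ht
    (U.isWeightVector_castC F Θ' S' hl hw) (fun h => hw0 ((LinearEquiv.map_eq_zero_iff _).mp h)) hS'
  have h1 : l' + 1 = 2 * (U.dim (U.cmProd F Θ') - q) := by omega
  have e : w = U.castC _ hl.symm (U.castC _ hl w) := by rw [castC_castC, castC_self]
  refine ⟨by omega, U.castC _ h1 y', U.isWeightVector_castC F Θ' _ h1 hw', ?_, ?_⟩
  · rw [e, cupC_castC_left, cupC_castC_right, castC_castC, trC_castC]; exact htr1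
  · rw [e, cupC_castC_left, cupC_castC_right, castC_castC, trC_castC]; exact htr2

end Partner

end Universe

end Summit.HodgeConjecture.CorCM

end
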